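import Literature.Analysis.FluidPDE.ClassicalGradientSmoothing
import Literature.Analysis.FluidPDE.KatoLocalBoundedPicard
import Literature.Analysis.UnboundedOperators.HeatKernelBoundedData
import HarnessLib

/-!
# Bounded classical solutions: gradient smoothing with any delay, and time increments

Analysis/FluidPDE proof file (theorems only, everything proved), continuing
`ClassicalGradientSmoothing.lean` (KNSS 2009 (4.10), `k = 1`, quantitative by scaling):

* `exists_norm_fderiv_le_of_classical_unit_delay` / `exists_norm_fderiv_le_of_speed_le_delay` —
  the gradient bound with an arbitrary fixed delay `d > 0`: `‖∇u(t, x)‖ ≤ C_d G²/ν` for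
  `t ∈ (d ν/G², T')` whenever the classical solution is bounded by `G` on `[0, T']` (slices
  uniformly in `L²`);
* `exists_norm_sub_le_of_classical_unit_delay` / `exists_norm_sub_le_of_speed_le_delay` — the
  **time increments**: `‖u(t, x) − u(s, x)‖ ≤ C_d G² √((t − s)/ν)` for
  `d ν/G² < s < t < T'`, `t − s ≤ ν/G²` (the mild formula from `s`: the caloric part moves by
  `≲ ‖∇u(s)‖_∞ √(ν(t−s))`, mollification of Lipschitz data,
  `norm_heatExtension_sub_self_le_of_holder`; the Duhamel part is `≲ G² √((t−s)/ν)`,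
  `exists_norm_oseenDuhamel_le_mul`).

Together with the early window (`exists_earlyWindow_norm_le`) these give the space–time cell of the
"occupation quantum": near a point where the speed is close to its running maximum `G`, the speed
stays above `G/2` on a parabolic cell of size `(ν/G) × (ν/G²)`.

## References

* G. Koch, N. Nadirashvili, G. Seregin, V. Šverák, Acta Math. 203 (2009) = arXiv:0709.3599, §4,
  Prop. 4.1, (4.10)–(4.11). [KochNadirashviliSereginSverak2009]
-/

noncomputable section

open MeasureTheory Set Function Filter
open scoped ENNReal NNReal

namespace Literature.Analysis.FluidPDE

open UnboundedOperators (heatExtension norm_heatExtension_sub_self_le_of_holder)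

/-! ### Unit viscosity, unit bound, arbitrary delay -/

/-- **Gradient bound for unit-bounded classical solutions with delay `d`** (`ν = 1`): for every
`d > 0` there is `C₁ = C₁(d)` such that every classical solution on `ℝ³ × (a, b)` with `‖u‖ ≤ 1` on
`(a, T] × ℝ³`, `T < b`, and `‖u(t)‖_{L²} ≤ K < ∞` there, has `‖∇u(t, x)‖ ≤ C₁` for all `x` and all
`t ∈ (a + d, T)` (as `exists_norm_fderiv_le_of_classical_unit`, with `δ = d` in
`IsDriftMildOn.exists_norm_iteratedFDeriv_le`).
[cite: KochNadirashviliSereginSverak2009, Prop. 4.1 and (4.10) (arXiv:0709.3599 §4)] -/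
theorem exists_norm_fderiv_le_of_classical_unit_delay {d : ℝ} (hd : 0 < d) :
    ∃ C₁ : ℝ, ∀ {a b T : ℝ} {u : ℝ → EuclideanSpace ℝ (Fin 3) → EuclideanSpace ℝ (Fin 3)}
      {p : ℝ → EuclideanSpace ℝ (Fin 3) → ℝ}, IsClassicalNSSolutionOn (Ioo a b) 1 0 u p →
      a < T → T < b → (∀ t ∈ Ioc a T, ∀ x, ‖u t x‖ ≤ 1) → ∀ {K : ℝ≥0∞}, K ≠ ∞ →
      (∀ t ∈ Ioc a T, eLpNorm (u t) 2 volume ≤ K) →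
      ∀ t ∈ Ioo (a + d) T, ∀ x, ‖fderiv ℝ (u t) x‖ ≤ C₁ := by
  obtain ⟨C, hC⟩ := IsDriftMildOn.exists_norm_iteratedFDeriv_le
    (E := EuclideanSpace ℝ (Fin 3)) 1 (δ := d) (N := 1) hd zero_le_one
  refine ⟨C, ?_⟩
  intro a b T u p hcl haT hTb hbd K hK hL2 t ht x
  classical
  set S : Set (ℝ × EuclideanSpace ℝ (Fin 3)) := Ioo a T ×ˢ univ with hS
  set U : ℝ → EuclideanSpace ℝ (Fin 3) → EuclideanSpace ℝ (Fin 3) :=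
    fun τ y => if τ ∈ Ioo a T then u τ y else 0 with hU
  have hUeq : ∀ {τ : ℝ}, τ ∈ Ioo a T → U τ = u τ := by
    intro τ hτ; funext y; simp only [hU, if_pos hτ]
  have hUunc : uncurry U = S.piecewise (uncurry u) 0 := by
    funext z
    obtain ⟨τ, y⟩ := z
    by_cases hτ : τ ∈ Ioo a T
    · have hz : (τ, y) ∈ S := mk_mem_prod hτ (mem_univ y)
      simp only [uncurry_apply_pair, hU, if_pos hτ, piecewise_eq_of_mem _ _ _ hz]
    · have hz : (τ, y) ∉ S := fun h => hτ (mem_prod.1 h).1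
      simp only [uncurry_apply_pair, hU, if_neg hτ, piecewise_eq_of_notMem _ _ _ hz,
        Pi.zero_apply]
  have hmeas : Measurable (uncurry U) := by
    rw [hUunc]
    refine ContinuousOn.measurable_piecewise ?_ continuousOn_const
      (measurableSet_Ioo.prod MeasurableSet.univ)
    exact hcl.smooth_velocity.continuousOn.mono (prod_mono (Ioo_subset_Ioo_right hTb.le) subset_rfl)
  have hDM : IsDriftMildOn a T 1 U (fun _ => (0 : EuclideanSpace ℝ (Fin 3))) := by
    refine ⟨hmeas, measurable_const, ?_, fun _ => by simp, ?_⟩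
    · intro τ hτ y
      rw [hUeq hτ]
      exact hbd τ ⟨hτ.1, hτ.2.le⟩ y
    · intro s t' hs hst ht' y
      have hsI : s ∈ Ioo a T := ⟨hs, hst.trans ht'⟩
      have htI : t' ∈ Ioo a T := ⟨hs.trans hst, ht'⟩
      have hadd : (fun τ z => U τ z + (0 : EuclideanSpace ℝ (Fin 3))) = U := by
        funext τ z; rw [add_zero]
      rw [hadd, hUeq htI, hUeq hsI]
      have hcongr : oseenDuhamel 1 s U U t' y = oseenDuhamel 1 s u u t' y :=
        LongLivedOseenSolution.oseenDuhamel_congr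
          (fun τ hτ => hUeq ⟨hs.trans hτ.1, hτ.2.trans ht'⟩)
          (fun τ hτ => hUeq ⟨hs.trans hτ.1, hτ.2.trans ht'⟩) y
      rw [hcongr]
      exact mild_of_bounded_of_eLpNorm_two_le_of_lt hcl haT hTb hbd hK hL2 hs hst ht' y
  have htI : t ∈ Ioo a T := ⟨by linarith [ht.1], ht.2⟩
  have h := hC hDM t ht x
  rwa [hUeq htI, norm_iteratedFDeriv_one] at h

/-- **Time increments of unit-bounded classical solutions with delay `d`** (`ν = 1`): for every
`d > 0` there is `C₂ = C₂(d)` such that every classical solution on `ℝ³ × (a, b)` with `‖u‖ ≤ 1` on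
`(a, T] × ℝ³`, `T < b`, and `‖u(t)‖_{L²} ≤ K < ∞` there, satisfies
`‖u(t, x) − u(s, x)‖ ≤ C₂ √(t − s)` for all `x` whenever `a + d < s < t < T` and `t − s ≤ 1` (mild
formula from `s`, `mild_of_bounded_of_eLpNorm_two_le_of_lt`: caloric part by the Lipschitz bound
`‖∇u(s)‖ ≤ C₁(d)` and `norm_heatExtension_sub_self_le_of_holder`, Duhamel part by
`exists_norm_oseenDuhamel_le_mul`).
[cite: KochNadirashviliSereginSverak2009, Prop. 4.1 and (4.11) (arXiv:0709.3599 §4)] -/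
theorem exists_norm_sub_le_of_classical_unit_delay {d : ℝ} (hd : 0 < d) :
    ∃ C₂ : ℝ, ∀ {a b T : ℝ} {u : ℝ → EuclideanSpace ℝ (Fin 3) → EuclideanSpace ℝ (Fin 3)}
      {p : ℝ → EuclideanSpace ℝ (Fin 3) → ℝ}, IsClassicalNSSolutionOn (Ioo a b) 1 0 u p →
      a < T → T < b → (∀ t ∈ Ioc a T, ∀ x, ‖u t x‖ ≤ 1) → ∀ {K : ℝ≥0∞}, K ≠ ∞ →
      (∀ t ∈ Ioc a T, eLpNorm (u t) 2 volume ≤ K) →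
      ∀ s t : ℝ, a + d < s → s < t → t < T → t - s ≤ 1 →
      ∀ x, ‖u t x - u s x‖ ≤ C₂ * Real.sqrt (t - s) := by
  obtain ⟨C₁, hC₁⟩ := exists_norm_fderiv_le_of_classical_unit_delay hd
  obtain ⟨C₀, hC₀, hB⟩ := exists_norm_oseenDuhamel_le_mul (E := EuclideanSpace ℝ (Fin 3))
  set A : ℝ := 1 + 2 * (2 : ℝ) ^ ((Module.finrank ℝ (EuclideanSpace ℝ (Fin 3)) : ℝ) / 2) with hA
  have hA0 : 0 ≤ A := by rw [hA]; positivity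
  -- `C₁` may be negative a priori; use `max C₁ 0`
  refine ⟨A * max C₁ 0 + 2 * C₀, ?_⟩
  intro a b T u p hcl haT hTb hbd K hK hL2 s t hs hst htT hts x
  have has : a < s := by linarith
  have hsT : s ∈ Ioo (a + d) T := ⟨hs, hst.trans htT⟩
  have hts0 : 0 < t - s := sub_pos.2 hst
  -- the mild formula from `s`
  have hmild := mild_of_bounded_of_eLpNorm_two_le_of_lt hcl haT hTb hbd hK hL2 has hst htT x
  -- the caloric part: Lipschitz data
  have hLip : ∀ y z, ‖u s y - u s z‖ ≤ max C₁ 0 * ‖y - z‖ := by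
    intro y z
    have hdiff : ∀ w ∈ (univ : Set (EuclideanSpace ℝ (Fin 3))), DifferentiableAt ℝ (u s) w :=
      fun w _ => ((hcl.contDiff_velocity ⟨has, hst.trans (htT.trans hTb)⟩).differentiable
        (by simp)) w
    have hbound : ∀ w ∈ (univ : Set (EuclideanSpace ℝ (Fin 3))), ‖fderiv ℝ (u s) w‖ ≤ max C₁ 0 :=
      fun w _ => (hC₁ hcl haT hTb hbd hK hL2 s hsT w).trans (le_max_left _ _)
    exact convex_univ.norm_image_sub_le_of_norm_fderiv_le hdiff hbound (mem_univ z) (mem_univ y)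
  have hcont : Continuous (u s) :=
    (hcl.contDiff_velocity ⟨has, hst.trans (htT.trans hTb)⟩).continuous
  have hbd_s : ∀ z, ‖u s z‖ ≤ 1 := fun z => hbd s ⟨has, (hst.trans htT).le⟩ z
  have hheat : ‖heatExtension (u s) (t - s) x - u s x‖ ≤
      A * max C₁ 0 * (t - s) ^ ((1 : ℝ) / 2) := by
    have h := norm_heatExtension_sub_self_le_of_holder hcont hbd_s (le_max_right _ _) zero_le_one
      le_rfl (fun y z => by rw [Real.rpow_one]; exact hLip y z) hts0 x
    rwa [hA]
  -- the Duhamel part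
  have hbdI : ∀ τ ∈ Ioo s t, ∀ y, ‖u τ y‖ ≤ 1 :=
    fun τ hτ y => hbd τ ⟨has.trans hτ.1, (hτ.2.trans htT).le⟩ y
  have hduh : ‖oseenDuhamel 1 s u u t x‖ ≤ 2 * C₀ * Real.sqrt (t - s) := by
    have h := hB one_pos hst zero_le_one zero_le_one hbdI hbdI x
    rw [Real.one_rpow] at h
    linarith
  -- assemble
  have hsqrt : (t - s) ^ ((1 : ℝ) / 2) = Real.sqrt (t - s) := by
    rw [Real.sqrt_eq_rpow]
  calc ‖u t x - u s x‖
      = ‖(heatExtension (u s) (t - s) x - u s x) - oseenDuhamel 1 s u u t x‖ := by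
        rw [hmild]; congr 1; abel
    _ ≤ ‖heatExtension (u s) (t - s) x - u s x‖ + ‖oseenDuhamel 1 s u u t x‖ := norm_sub_le _ _
    _ ≤ A * max C₁ 0 * Real.sqrt (t - s) + 2 * C₀ * Real.sqrt (t - s) := by
        rw [← hsqrt] at hduh ⊢; exact add_le_add hheat hduh
    _ = (A * max C₁ 0 + 2 * C₀) * Real.sqrt (t - s) := by ring

/-! ### General viscosity and bound -/

/-- **Quantitative gradient smoothing under a speed bound, arbitrary delay.** For every `d > 0`
there is `C = C(d)` such that: for `ν > 0`, `G > 0`, every classical solution with viscosity `ν` on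
`ℝ³ × [0, T)` bounded by `G` on `[0, T'] × ℝ³` (`T' < T`) with slices uniformly in `L²` there
satisfies `‖∇u(t, x)‖ ≤ C G²/ν` for all `x` and all `t ∈ (d ν/G², T')`.
[cite: KochNadirashviliSereginSverak2009, Prop. 4.1 and (4.10) (arXiv:0709.3599 §4)] -/
theorem exists_norm_fderiv_le_of_speed_le_delay {d : ℝ} (hd : 0 < d) :
    ∃ C : ℝ, ∀ {ν T T' G : ℝ} {u : ℝ → EuclideanSpace ℝ (Fin 3) → EuclideanSpace ℝ (Fin 3)}
      {p : ℝ → EuclideanSpace ℝ (Fin 3) → ℝ}, 0 < ν → 0 < G →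
      IsClassicalNSSolutionOn (Ico 0 T) ν 0 u p → 0 < T' → T' < T →
      (∀ t ∈ Icc 0 T', ∀ x, ‖u t x‖ ≤ G) → ∀ {K : ℝ≥0∞}, K ≠ ∞ →
      (∀ t ∈ Icc 0 T', eLpNorm (u t) 2 volume ≤ K) →
      ∀ t ∈ Ioo (d * ν / G ^ 2) T', ∀ x, ‖fderiv ℝ (u t) x‖ ≤ C * G ^ 2 / ν := by
  obtain ⟨C₁, hC₁⟩ := exists_norm_fderiv_le_of_classical_unit_delay hd
  refine ⟨C₁, ?_⟩
  intro ν T T' G u p hν hG hcl hT' hT'T hbd K hK hL2 t ht x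
  set α : ℝ := G⁻¹ with hα
  set γ : ℝ := ν / G with hγ
  set β : ℝ := ν / G ^ 2 with hβ
  have hαpos : 0 < α := by rw [hα]; positivity
  have hγpos : 0 < γ := by rw [hγ]; positivity
  have hβpos : 0 < β := by rw [hβ]; positivity
  have hβαγ : β = α * γ := by rw [hβ, hα, hγ]; field_simp
  have hcl' := (hcl.mono Ioo_subset_Ico_self (uniqueDiffOn_Ioo 0 T)).stRescale hαpos hγpos hβαγ 0 0
  have hS : ((fun r => (0 : ℝ) + β * r) ⁻¹' Ioo 0 T) = Ioo 0 (T / β) := by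
    ext r
    simp only [mem_preimage, mem_Ioo, zero_add]
    constructor
    · rintro ⟨h1, h2⟩
      exact ⟨(mul_pos_iff_of_pos_left hβpos).1 h1, (lt_div_iff₀' hβpos).2 h2⟩
    · rintro ⟨h1, h2⟩
      exact ⟨mul_pos hβpos h1, (lt_div_iff₀' hβpos).1 h2⟩
  have hν1 : α * ν / γ = 1 := by rw [hα, hγ]; field_simp
  rw [hS, hν1, smul_stPull_zero] at hcl'
  set w : ℝ → EuclideanSpace ℝ (Fin 3) → EuclideanSpace ℝ (Fin 3) := α • stPull β γ 0 0 u with hw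
  have hwapp : ∀ s y, w s y = α • u (β * s) (γ • y) := by
    intro s y
    simp only [hw, Pi.smul_apply, stPull_apply, zero_add]
  have hT'β : 0 < T' / β := div_pos hT' hβpos
  have hT'βT : T' / β < T / β := div_lt_div_of_pos_right hT'T hβpos
  have hmemI : ∀ {s : ℝ}, s ∈ Ioc 0 (T' / β) → β * s ∈ Icc 0 T' := by
    intro s hs
    refine ⟨(mul_pos hβpos hs.1).le, ?_⟩
    have := hs.2
    rwa [le_div_iff₀' hβpos] at this
  have hbd' : ∀ s ∈ Ioc 0 (T' / β), ∀ y, ‖w s y‖ ≤ 1 := by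
    intro s hs y
    rw [hwapp, norm_smul, Real.norm_of_nonneg hαpos.le, hα]
    have := hbd (β * s) (hmemI hs) (γ • y)
    calc G⁻¹ * ‖u (β * s) (γ • y)‖ ≤ G⁻¹ * G := by gcongr
      _ = 1 := inv_mul_cancel₀ hG.ne'
  set K' : ℝ≥0∞ := ENNReal.ofReal |α| * (ENNReal.ofReal (γ ^ 3)⁻¹) ^ (1 / 2 : ℝ) * K with hK'
  have hK'top : K' ≠ ∞ := by
    refine ENNReal.mul_ne_top (ENNReal.mul_ne_top ENNReal.ofReal_ne_top ?_) hK
    exact ENNReal.rpow_ne_top_of_nonneg (by norm_num) ENNReal.ofReal_ne_top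
  have hL2' : ∀ s ∈ Ioc 0 (T' / β), eLpNorm (w s) 2 volume ≤ K' := by
    intro s hs
    have h1 : w s = fun y => α • u (β * s) ((0 : EuclideanSpace ℝ (Fin 3)) + γ • y) := by
      funext y; rw [hwapp, zero_add]
    rw [h1]
    refine (eLpNorm_two_smul_comp_affine_le α hγpos 0).trans ?_
    rw [hK']
    gcongr
    exact hL2 (β * s) (hmemI hs)
  have htβ : t / β ∈ Ioo (0 + d) (T' / β) := by
    refine ⟨?_, div_lt_div_of_pos_right ht.2 hβpos⟩
    rw [zero_add, lt_div_iff₀ hβpos, hβ]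
    calc d * (ν / G ^ 2) = d * ν / G ^ 2 := by ring
      _ < t := ht.1
  have key := hC₁ hcl' hT'β hT'βT hbd' hK'top hL2' (t / β) htβ (γ⁻¹ • x)
  have hdpos : 0 < d * ν / G ^ 2 := by positivity
  have htT : t ∈ Ico 0 T := ⟨(hdpos.trans ht.1).le, ht.2.trans hT'T⟩
  have hdiff : DifferentiableAt ℝ (stPull β γ 0 0 u (t / β)) (γ⁻¹ • x) :=
    differentiable_stPull_slice
      (((hcl.contDiff_velocity (by simpa [mul_div_cancel₀ _ hβpos.ne'] using htT)).differentiable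
        (by simp))) _
  have hD : fderiv ℝ (w (t / β)) (γ⁻¹ • x) = (α * γ) • fderiv ℝ (u t) x := by
    have h1 : w (t / β) = α • stPull β γ 0 0 u (t / β) := rfl
    rw [h1, fderiv_const_smul hdiff, fderiv_stPull, smul_smul]
    congr 2
    · rw [zero_add, mul_div_cancel₀ _ hβpos.ne']
    · rw [zero_add, smul_smul, mul_inv_cancel₀ hγpos.ne', one_smul]
  rw [hD, norm_smul, Real.norm_of_nonneg (by positivity)] at key
  have hαγ : α * γ = ν / G ^ 2 := by rw [hα, hγ]; field_simp
  rw [hαγ] at key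
  have hG2 : 0 < G ^ 2 := by positivity
  have key' : ‖fderiv ℝ (u t) x‖ ≤ C₁ / (ν / G ^ 2) := by
    rw [le_div_iff₀ (div_pos hν hG2)]
    calc ‖fderiv ℝ (u t) x‖ * (ν / G ^ 2) = ν / G ^ 2 * ‖fderiv ℝ (u t) x‖ := mul_comm _ _
      _ ≤ C₁ := key
  calc ‖fderiv ℝ (u t) x‖ ≤ C₁ / (ν / G ^ 2) := key'
    _ = C₁ * G ^ 2 / ν := by field_simp

/-- **Time increments under a speed bound (scale-invariant form).** For every `d > 0` there is
`C = C(d)` such that: for `ν > 0`, `G > 0`, every classical solution with viscosity `ν` on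
`ℝ³ × [0, T)` bounded by `G` on `[0, T'] × ℝ³` (`T' < T`) with slices uniformly in `L²` there
satisfies `‖u(t, x) − u(s, x)‖ ≤ C G² √((t − s)/ν)` for all `x` whenever
`d ν/G² < s < t < T'` and `t − s ≤ ν/G²` (scaling `u ↦ G⁻¹u(νt/G², νx/G)` of
`exists_norm_sub_le_of_classical_unit_delay`).
[cite: KochNadirashviliSereginSverak2009, Prop. 4.1 and (4.11) (arXiv:0709.3599 §4)] -/
theorem exists_norm_sub_le_of_speed_le_delay {d : ℝ} (hd : 0 < d) :
    ∃ C : ℝ, ∀ {ν T T' G : ℝ} {u : ℝ → EuclideanSpace ℝ (Fin 3) → EuclideanSpace ℝ (Fin 3)}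
      {p : ℝ → EuclideanSpace ℝ (Fin 3) → ℝ}, 0 < ν → 0 < G →
      IsClassicalNSSolutionOn (Ico 0 T) ν 0 u p → 0 < T' → T' < T →
      (∀ t ∈ Icc 0 T', ∀ x, ‖u t x‖ ≤ G) → ∀ {K : ℝ≥0∞}, K ≠ ∞ →
      (∀ t ∈ Icc 0 T', eLpNorm (u t) 2 volume ≤ K) →
      ∀ s t : ℝ, d * ν / G ^ 2 < s → s < t → t < T' → t - s ≤ ν / G ^ 2 →
      ∀ x, ‖u t x - u s x‖ ≤ C * G ^ 2 * Real.sqrt ((t - s) / ν) := by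
  obtain ⟨C₂, hC₂⟩ := exists_norm_sub_le_of_classical_unit_delay hd
  refine ⟨max C₂ 0, ?_⟩
  intro ν T T' G u p hν hG hcl hT' hT'T hbd K hK hL2 s t hs hst htT' hts x
  set α : ℝ := G⁻¹ with hα
  set γ : ℝ := ν / G with hγ
  set β : ℝ := ν / G ^ 2 with hβ
  have hαpos : 0 < α := by rw [hα]; positivity
  have hγpos : 0 < γ := by rw [hγ]; positivity
  have hβpos : 0 < β := by rw [hβ]; positivity
  have hβαγ : β = α * γ := by rw [hβ, hα, hγ]; field_simp
  have hcl' := (hcl.mono Ioo_subset_Ico_self (uniqueDiffOn_Ioo 0 T)).stRescale hαpos hγpos hβαγ 0 0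
  have hS : ((fun r => (0 : ℝ) + β * r) ⁻¹' Ioo 0 T) = Ioo 0 (T / β) := by
    ext r
    simp only [mem_preimage, mem_Ioo, zero_add]
    constructor
    · rintro ⟨h1, h2⟩
      exact ⟨(mul_pos_iff_of_pos_left hβpos).1 h1, (lt_div_iff₀' hβpos).2 h2⟩
    · rintro ⟨h1, h2⟩
      exact ⟨mul_pos hβpos h1, (lt_div_iff₀' hβpos).1 h2⟩
  have hν1 : α * ν / γ = 1 := by rw [hα, hγ]; field_simp
  rw [hS, hν1, smul_stPull_zero] at hcl'
  set w : ℝ → EuclideanSpace ℝ (Fin 3) → EuclideanSpace ℝ (Fin 3) := α • stPull β γ 0 0 u with hw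
  have hwapp : ∀ s y, w s y = α • u (β * s) (γ • y) := by
    intro s y
    simp only [hw, Pi.smul_apply, stPull_apply, zero_add]
  have hT'β : 0 < T' / β := div_pos hT' hβpos
  have hT'βT : T' / β < T / β := div_lt_div_of_pos_right hT'T hβpos
  have hmemI : ∀ {s : ℝ}, s ∈ Ioc 0 (T' / β) → β * s ∈ Icc 0 T' := by
    intro s hs
    refine ⟨(mul_pos hβpos hs.1).le, ?_⟩
    have := hs.2
    rwa [le_div_iff₀' hβpos] at this
  have hbd' : ∀ s ∈ Ioc 0 (T' / β), ∀ y, ‖w s y‖ ≤ 1 := by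
    intro s hs y
    rw [hwapp, norm_smul, Real.norm_of_nonneg hαpos.le, hα]
    have := hbd (β * s) (hmemI hs) (γ • y)
    calc G⁻¹ * ‖u (β * s) (γ • y)‖ ≤ G⁻¹ * G := by gcongr
      _ = 1 := inv_mul_cancel₀ hG.ne'
  set K' : ℝ≥0∞ := ENNReal.ofReal |α| * (ENNReal.ofReal (γ ^ 3)⁻¹) ^ (1 / 2 : ℝ) * K with hK'
  have hK'top : K' ≠ ∞ := by
    refine ENNReal.mul_ne_top (ENNReal.mul_ne_top ENNReal.ofReal_ne_top ?_) hK
    exact ENNReal.rpow_ne_top_of_nonneg (by norm_num) ENNReal.ofReal_ne_top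
  have hL2' : ∀ s ∈ Ioc 0 (T' / β), eLpNorm (w s) 2 volume ≤ K' := by
    intro s hs
    have h1 : w s = fun y => α • u (β * s) ((0 : EuclideanSpace ℝ (Fin 3)) + γ • y) := by
      funext y; rw [hwapp, zero_add]
    rw [h1]
    refine (eLpNorm_two_smul_comp_affine_le α hγpos 0).trans ?_
    rw [hK']
    gcongr
    exact hL2 (β * s) (hmemI hs)
  -- rescaled times
  have hG2 : 0 < G ^ 2 := by positivity
  have hsβ : 0 + d < s / β := by
    rw [zero_add, lt_div_iff₀ hβpos, hβ]
    have := hs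
    rw [div_lt_iff₀ hG2] at this
    calc d * (ν / G ^ 2) = d * ν / G ^ 2 := by ring
      _ < s := by rwa [div_lt_iff₀ hG2]
  have hstβ : s / β < t / β := div_lt_div_of_pos_right hst hβpos
  have htβ : t / β < T' / β := div_lt_div_of_pos_right htT' hβpos
  have htsβ : t / β - s / β ≤ 1 := by
    rw [← sub_div, div_le_one hβpos, hβ]; exact hts
  have key := hC₂ hcl' hT'β hT'βT hbd' hK'top hL2' (s / β) (t / β) hsβ hstβ htβ htsβ (γ⁻¹ • x)
  -- undo the scaling
  have hwt : w (t / β) (γ⁻¹ • x) = α • u t x := by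
    rw [hwapp, mul_div_cancel₀ _ hβpos.ne', smul_smul, mul_inv_cancel₀ hγpos.ne', one_smul]
  have hws : w (s / β) (γ⁻¹ • x) = α • u s x := by
    rw [hwapp, mul_div_cancel₀ _ hβpos.ne', smul_smul, mul_inv_cancel₀ hγpos.ne', one_smul]
  rw [hwt, hws, ← smul_sub, norm_smul, Real.norm_of_nonneg hαpos.le] at key
  -- `key : G⁻¹ ‖u t x − u s x‖ ≤ C₂ √((t − s)/β)` with `β = ν/G²`
  have hsq : Real.sqrt (t / β - s / β) = G * Real.sqrt ((t - s) / ν) := by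
    rw [← sub_div, hβ, div_div_eq_mul_div, mul_comm (t - s), mul_div_assoc,
      Real.sqrt_mul' _ (div_nonneg (sub_nonneg.2 hst.le) hν.le), Real.sqrt_sq hG.le]
  rw [hsq, hα] at key
  have hC₂le : C₂ * (G * Real.sqrt ((t - s) / ν)) ≤ max C₂ 0 * (G * Real.sqrt ((t - s) / ν)) :=
    mul_le_mul_of_nonneg_right (le_max_left _ _) (by positivity)
  have key2 : G⁻¹ * ‖u t x - u s x‖ ≤ max C₂ 0 * (G * Real.sqrt ((t - s) / ν)) := key.trans hC₂le
  rw [inv_mul_le_iff₀ hG] at key2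
  calc ‖u t x - u s x‖ ≤ G * (max C₂ 0 * (G * Real.sqrt ((t - s) / ν))) := key2
    _ = max C₂ 0 * G ^ 2 * Real.sqrt ((t - s) / ν) := by ring

end Literature.Analysis.FluidPDE

end
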